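import Summits.QuantumFields.BalabanUV.T4Continuum.Support.ShellMeasureLocalGradientTailJet

/-!
# `T4Continuum.ShellMeasureGradientTailPairing` — WALL §2 (a) item (P4), the `HD`-terms of [Balaban1985Variational] (80)
# in BOND-LOCAL form, file 1∕2 (engine): the ℓ¹ size of a bond field, the bond pairing `⟨A, B⟩_π = Σ_b π(A(b), B(b))`, the
# KEY DEVICE `|DV(y)h| ≤ ‖locGrad V y‖_∞·‖h‖₁`, the product rule for the pairing and the VOLUME-FREE bond-local gradient
# bounds of a pairing term `⟨F, G⟩_π` and of a substituted functional `V₀ ∘ Θ` from COLUMN-SUM bounds along single-bond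
# directions (cell `pub-balaban`, sub-cell `t4`, spine estimate NE7c (node U5b), owner lineage `b2b-balaban-t4-ne7c-p1`
# gen 29, table `LEAVES-NE7c-P1.md` row S66 file 2a; imports the owner's S62 `ShellMeasureLocalGradientTailJet` (hence
# `…LocalGradientTail`, `…WilsonGradientTail`) ONLY; [folklore]; 0 sorry)

HONEST FRAMING.  Finite four-torus programme, rung (B)+1 only — NOT infinite volume, NOT a mass gap, NOT the Clay
problem, NOT summit progress; (B), `BetaPertHyp`, (B^μ) are not consumed.  NE7c (`T4IndicatorShell.ShellWeightBound`)
is NOT PRINTED and NOT PROVED; «NE7c ⇐ the named binders» (WALL `t4/b2b-balaban-t4-ne7c-p1/WALL-NE7c-P1.md` §2).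
Elementary calculus on complex normed spaces ([folklore]); nothing printed is asserted or cited as a fact; no
`def … : Prop` (the two `def`s are DATA: the ℓ¹ size `norm₁` and the bond pairing `pair`).  HONEST DEPENDENCY (cell):
continuum YM on T⁴ ⇐ BetaPertH ∧ nine spine estimates (0/9 proved); BetaPertH ⇐ (D1) ∧ (D4) ∧ CAP+tail; G-an2-4 gates
asym, D1 and NE2/3/4.

THE POINT (the owner's say on row S66's «possible f2», journal INTENT NE7c-S66 f2).  The crew's S66 f1
`ShellMeasureGradientTailHD.prop4Hyp_of_HD_binders` (p221067) is the correct POTENTIAL-level composition of (80), but its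
binders — `‖H‖ ≤ B₀` in operator norm, ONE global cubic constant for `V₀`, the gradient in the DUAL norm — become
EXTENSIVE when the spaces are the sup-normed bond fields of a block (the dual of the sup norm is ℓ¹; a global cubic
constant grows with the number of plaquettes), whereas (85)–(89) (p. 291, locators only) are PER-BOND sup bounds with
O(1) constants, paid for by KERNEL DECAY ((73) `|𝔇(A′; c, b)| ≤ O(1)C₃ε₃(Lʲη)^{−d+1}e^{−½δ₀d(c₋,y)}`, (46) = [5] Thm 3.12,
[5] (3.132)).  The honest abstract currency is therefore: sup norm AND ℓ¹ size on `Λ → 𝔄`, and COLUMN-SUM bounds of the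
derivative kernels along single-bond directions.  Here, the engine:
* §1 `norm₁ A := Σ_b ‖A b‖`, `norm₁_single` (`‖ι_b X‖₁ = ‖X‖`); `pair π A B := Σ_b π (A b) (B b)` with
  `norm_pair_le_sup_one` (`≤ ‖π‖·‖A‖_∞·‖B‖₁`) and `norm_pair_le_one_sup`; **`norm_fderiv_apply_le_locGrad`**: `|DV(y)h| ≤
  ‖locGrad V y‖_∞·‖h‖₁` (S62 f1's `fderiv_apply_eq_sum_locGrad`) — a bond-local gradient bound acts on ℓ¹-small
  directions.
* §2 `analyticAt_clm_apply`, `analyticAt_pair`; **`hasFDerivAt_pair`** (`D⟨F, G⟩_π(x)h = ⟨DF(x)h, G(x)⟩_π + ⟨F(x),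
  DG(x)h⟩_π`); **`norm_locGrad_pair_le`**: from `‖DF(x)(ι_b X)‖₁ ≤ c_F‖X‖`, `‖DG(x)(ι_b X)‖₁ ≤ c_G‖X‖`,
  `‖locGrad ⟨F, G⟩_π x b‖ ≤ ‖π‖·(c_F·‖G x‖_∞ + ‖F x‖_∞·c_G)` — no volume factor.
* §3 **`norm_locGrad_comp_le`**: for `DΘ(x) = id − M'` with `‖M'(ι_b X)‖₁ ≤ c_M‖X‖`,
  `‖locGrad (V₀ ∘ Θ) x b‖ ≤ ‖locGrad V₀ (Θ x)‖_∞·(1 + c_M)`.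
File 2b (`ShellMeasureGradientTailHDLocal`) assembles (80)'s four terms into `Prop4Hyp (locGrad V) C r` with `C` a
polynomial in the binders' constants and NO `#Λ`.  NOT HERE: «decay kernel ⇒ row∕column sums» (crew f3), the weighted
multi-scale norms (row S65), the [dict] (node O).  No estimate of Bałaban's at a live level is discharged.
-/

noncomputable section

open Metric Set Filter
open scoped Topology

namespace Summit.QuantumFields.BalabanUV.T4Continuum.ShellMeasureGradientTailPairing

open Literature.MathematicalPhysics.QuantumFieldTheory.Balaban1983to89
open B11Prop6Scheme (Prop4Hyp)
open ShellMeasureLocalGradientTail (sgl sgl_apply locGrad locGrad_apply locGrad_apply_apply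
  fderiv_apply_eq_sum_locGrad differentiableOn_locGrad)

variable {Λ : Type*} [Fintype Λ] [DecidableEq Λ] {𝔄 : Type*} [NormedAddCommGroup 𝔄] [NormedSpace ℂ 𝔄]

/-! ## §1 The ℓ¹ seminorm, the bond pairing, and the key device -/

/-- The ℓ¹ SIZE of a bond field: `‖A‖₁ = Σ_b ‖A(b)‖` (the currency in which KERNEL DECAY is paid: column sums).
[folklore] -/
def norm₁ (A : Λ → 𝔄) : ℝ := ∑ b, ‖A b‖

omit [DecidableEq Λ] [NormedSpace ℂ 𝔄] in
/-- `0 ≤ ‖A‖₁`. [folklore] -/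
theorem norm₁_nonneg (A : Λ → 𝔄) : 0 ≤ norm₁ A := Finset.sum_nonneg fun _ _ => norm_nonneg _

omit [NormedSpace ℂ 𝔄] in
/-- A single-bond field has ℓ¹ size `‖X‖`. [folklore] -/
theorem norm₁_single (b : Λ) (X : 𝔄) : norm₁ (Pi.single b X : Λ → 𝔄) = ‖X‖ := by
  unfold norm₁
  rw [Finset.sum_eq_single b (fun b' _ hb' => by rw [Pi.single_apply, if_neg hb', norm_zero])
    (fun h => absurd (Finset.mem_univ b) h)]
  simp

/-- THE BOND PAIRING `⟨A, B⟩_π = Σ_b π(A(b), B(b))` for a continuous bilinear `π` on the fibre (B11's `⟨·,·⟩`, one grid,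
extended bilinearly to `𝔤ᶜ`-valued fields). [folklore] -/
def pair (π : 𝔄 →L[ℂ] 𝔄 →L[ℂ] ℂ) (A B : Λ → 𝔄) : ℂ := ∑ b, π (A b) (B b)

omit [DecidableEq Λ] in
/-- `|⟨A, B⟩_π| ≤ ‖π‖·‖A‖_∞·‖B‖₁`. [folklore] -/
theorem norm_pair_le_sup_one (π : 𝔄 →L[ℂ] 𝔄 →L[ℂ] ℂ) (A B : Λ → 𝔄) :
    ‖pair π A B‖ ≤ ‖π‖ * ‖A‖ * norm₁ B := by
  unfold pair norm₁
  rw [Finset.mul_sum]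
  refine (norm_sum_le _ _).trans (Finset.sum_le_sum fun b _ => ?_)
  calc ‖π (A b) (B b)‖ ≤ ‖π‖ * ‖A b‖ * ‖B b‖ := π.le_opNorm₂ _ _
    _ ≤ ‖π‖ * ‖A‖ * ‖B b‖ := by
      gcongr
      exact norm_le_pi_norm A b

omit [DecidableEq Λ] in
/-- `|⟨A, B⟩_π| ≤ ‖π‖·‖A‖₁·‖B‖_∞`. [folklore] -/
theorem norm_pair_le_one_sup (π : 𝔄 →L[ℂ] 𝔄 →L[ℂ] ℂ) (A B : Λ → 𝔄) :
    ‖pair π A B‖ ≤ ‖π‖ * norm₁ A * ‖B‖ := by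
  unfold pair norm₁
  rw [Finset.mul_sum, Finset.sum_mul]
  refine (norm_sum_le _ _).trans (Finset.sum_le_sum fun b _ => ?_)
  calc ‖π (A b) (B b)‖ ≤ ‖π‖ * ‖A b‖ * ‖B b‖ := π.le_opNorm₂ _ _
    _ ≤ ‖π‖ * ‖A b‖ * ‖B‖ := by
      gcongr
      exact norm_le_pi_norm B b

/-- **THE KEY DEVICE.**  A BOND-LOCAL gradient bound acts on ℓ¹-SMALL directions:
`|DV(y)h| ≤ ‖locGrad V y‖_∞·‖h‖₁` (S62 f1 `fderiv_apply_eq_sum_locGrad`). [folklore] -/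
theorem norm_fderiv_apply_le_locGrad (V : (Λ → 𝔄) → ℂ) (y h : Λ → 𝔄) :
    ‖fderiv ℂ V y h‖ ≤ ‖locGrad V y‖ * norm₁ h := by
  rw [fderiv_apply_eq_sum_locGrad V y h, norm₁, Finset.mul_sum]
  refine (norm_sum_le _ _).trans (Finset.sum_le_sum fun b _ => ?_)
  calc ‖locGrad V y b (h b)‖ ≤ ‖locGrad V y b‖ * ‖h b‖ := (locGrad V y b).le_opNorm _
    _ ≤ ‖locGrad V y‖ * ‖h b‖ := by
      gcongr
      exact norm_le_pi_norm (locGrad V y) b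

/-! ## §2 Calculus of the pairing: product rule, analyticity, and the bond-local gradient bound -/

section Pairing

variable {E : Type*} [NormedAddCommGroup E] [NormedSpace ℂ E]

omit [Fintype Λ] [DecidableEq Λ] in
/-- Analyticity of `x ↦ f(x)(g(x))` for analytic `f` (CLM-valued) and `g` (evaluation is bilinear). [folklore] -/
theorem analyticAt_clm_apply {F G : Type*} [NormedAddCommGroup F] [NormedSpace ℂ F] [NormedAddCommGroup G]
    [NormedSpace ℂ G] {f : E → F →L[ℂ] G} {g : E → F} {x : E} (hf : AnalyticAt ℂ f x) (hg : AnalyticAt ℂ g x) :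
    AnalyticAt ℂ (fun x => f x (g x)) x := by
  have h1 : AnalyticAt ℂ (fun p : (F →L[ℂ] G) × F => (ContinuousLinearMap.id ℂ (F →L[ℂ] G)) p.1 p.2) (f x, g x) :=
    ContinuousLinearMap.analyticAt_bilinear _ _
  exact h1.comp₂ hf hg

omit [DecidableEq Λ] in
/-- `x ↦ ⟨F(x), G(x)⟩_π` is analytic where `F`, `G` are. [folklore] -/
theorem analyticAt_pair (π : 𝔄 →L[ℂ] 𝔄 →L[ℂ] ℂ) {F G : E → Λ → 𝔄} {x : E} (hF : AnalyticAt ℂ F x)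
    (hG : AnalyticAt ℂ G x) : AnalyticAt ℂ (fun x => pair π (F x) (G x)) x := by
  unfold pair
  refine Finset.analyticAt_fun_sum _ fun b _ => ?_
  have hFb : AnalyticAt ℂ (fun x => F x b) x :=
    ((ContinuousLinearMap.proj (R := ℂ) (φ := fun _ : Λ => 𝔄) b).analyticAt _).comp hF
  have hGb : AnalyticAt ℂ (fun x => G x b) x :=
    ((ContinuousLinearMap.proj (R := ℂ) (φ := fun _ : Λ => 𝔄) b).analyticAt _).comp hG
  exact analyticAt_clm_apply ((π.analyticAt _).comp hFb) hGb

omit [DecidableEq Λ] in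
/-- **PRODUCT RULE FOR THE PAIRING.**  `D⟨F, G⟩_π(x)h = ⟨DF(x)h, G(x)⟩_π + ⟨F(x), DG(x)h⟩_π`. [folklore] -/
theorem hasFDerivAt_pair (π : 𝔄 →L[ℂ] 𝔄 →L[ℂ] ℂ) {F G : E → Λ → 𝔄} {F' G' : E →L[ℂ] (Λ → 𝔄)} {x : E}
    (hF : HasFDerivAt F F' x) (hG : HasFDerivAt G G' x) :
    ∃ T : E →L[ℂ] ℂ, HasFDerivAt (fun x => pair π (F x) (G x)) T x ∧
      ∀ h, T h = pair π (F' h) (G x) + pair π (F x) (G' h) := by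
  -- per bond: `x ↦ π (F x b) (G x b)`
  have hb : ∀ b : Λ, HasFDerivAt (fun x => π (F x b) (G x b))
      ((π (F x b)).comp ((ContinuousLinearMap.proj b).comp G') +
        (π.comp ((ContinuousLinearMap.proj b).comp F')).flip (G x b)) x := by
    intro b
    have hFb : HasFDerivAt (fun x => F x b) ((ContinuousLinearMap.proj b).comp F') x :=
      (ContinuousLinearMap.proj (R := ℂ) (φ := fun _ : Λ => 𝔄) b).hasFDerivAt.comp x hF
    have hGb : HasFDerivAt (fun x => G x b) ((ContinuousLinearMap.proj b).comp G') x :=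
      (ContinuousLinearMap.proj (R := ℂ) (φ := fun _ : Λ => 𝔄) b).hasFDerivAt.comp x hG
    have hc : HasFDerivAt (fun x => π (F x b)) (π.comp ((ContinuousLinearMap.proj b).comp F')) x :=
      π.hasFDerivAt.comp x hFb
    exact hc.clm_apply hGb
  refine ⟨∑ b, ((π (F x b)).comp ((ContinuousLinearMap.proj b).comp G') +
      (π.comp ((ContinuousLinearMap.proj b).comp F')).flip (G x b)), ?_, fun h => ?_⟩
  · unfold pair
    exact HasFDerivAt.fun_sum fun b _ => hb b
  · simp [pair, Finset.sum_add_distrib, add_comm]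

/-- **BOND-LOCAL GRADIENT OF A PAIRING TERM.**  If along the single-bond direction `ι_b X` the derivatives satisfy
`‖DF(x)(ι_b X)‖₁ ≤ c_F‖X‖` and `‖DG(x)(ι_b X)‖₁ ≤ c_G‖X‖` (COLUMN-SUM bounds), then
`‖locGrad ⟨F, G⟩_π x b‖ ≤ ‖π‖·(c_F·‖G x‖_∞ + ‖F x‖_∞·c_G)` — no volume factor. [folklore] -/
theorem norm_locGrad_pair_le (π : 𝔄 →L[ℂ] 𝔄 →L[ℂ] ℂ) {F G : (Λ → 𝔄) → Λ → 𝔄}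
    {F' G' : (Λ → 𝔄) →L[ℂ] (Λ → 𝔄)} {x : Λ → 𝔄} (hF : HasFDerivAt F F' x) (hG : HasFDerivAt G G' x)
    (b : Λ) {cF cG : ℝ} (hcF : 0 ≤ cF) (hcG : 0 ≤ cG)
    (hF' : ∀ X : 𝔄, norm₁ (F' (Pi.single b X)) ≤ cF * ‖X‖) (hG' : ∀ X : 𝔄, norm₁ (G' (Pi.single b X)) ≤ cG * ‖X‖) :
    ‖locGrad (fun x => pair π (F x) (G x)) x b‖ ≤ ‖π‖ * (cF * ‖G x‖ + ‖F x‖ * cG) := by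
  obtain ⟨T, hT, hTh⟩ := hasFDerivAt_pair π hF hG
  refine ContinuousLinearMap.opNorm_le_bound _ (by positivity) fun X => ?_
  rw [locGrad_apply_apply, hT.fderiv, hTh]
  calc ‖pair π (F' (Pi.single b X)) (G x) + pair π (F x) (G' (Pi.single b X))‖
      ≤ ‖π‖ * norm₁ (F' (Pi.single b X)) * ‖G x‖ + ‖π‖ * ‖F x‖ * norm₁ (G' (Pi.single b X)) :=
        (norm_add_le _ _).trans (add_le_add (norm_pair_le_one_sup π _ _) (norm_pair_le_sup_one π _ _))
    _ ≤ ‖π‖ * (cF * ‖X‖) * ‖G x‖ + ‖π‖ * ‖F x‖ * (cG * ‖X‖) := by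
        gcongr
        · exact hF' X
        · exact hG' X
    _ = ‖π‖ * (cF * ‖G x‖ + ‖F x‖ * cG) * ‖X‖ := by ring

end Pairing

/-! ## §3 The substituted plaquette part `V₀ ∘ (id − HD)` -/

/-- **BOND-LOCAL GRADIENT OF `V₀ ∘ Θ`.**  For `Θ` with `DΘ(x) = id − M'` and the COLUMN-SUM bound
`‖M'(ι_b X)‖₁ ≤ c_M‖X‖`: `‖locGrad (V₀ ∘ Θ) x b‖ ≤ ‖locGrad V₀ (Θ x)‖_∞·(1 + c_M)` (the key device on the ℓ¹-small
direction `M'(ι_b X)`). [folklore] -/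
theorem norm_locGrad_comp_le {V₀ : (Λ → 𝔄) → ℂ} {Θ : (Λ → 𝔄) → Λ → 𝔄} {M' : (Λ → 𝔄) →L[ℂ] (Λ → 𝔄)}
    {x : Λ → 𝔄} (hΘ : HasFDerivAt Θ (ContinuousLinearMap.id ℂ (Λ → 𝔄) - M') x)
    (hV : DifferentiableAt ℂ V₀ (Θ x)) (b : Λ) {cM : ℝ} (hcM : 0 ≤ cM)
    (hM' : ∀ X : 𝔄, norm₁ (M' (Pi.single b X)) ≤ cM * ‖X‖) :
    ‖locGrad (V₀ ∘ Θ) x b‖ ≤ ‖locGrad V₀ (Θ x)‖ * (1 + cM) := by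
  have hD : HasFDerivAt (V₀ ∘ Θ) ((fderiv ℂ V₀ (Θ x)).comp (ContinuousLinearMap.id ℂ (Λ → 𝔄) - M')) x :=
    hV.hasFDerivAt.comp x hΘ
  refine ContinuousLinearMap.opNorm_le_bound _ (by positivity) fun X => ?_
  rw [locGrad_apply_apply, hD.fderiv]
  change ‖fderiv ℂ V₀ (Θ x) (Pi.single b X - M' (Pi.single b X))‖ ≤ _
  rw [map_sub]
  have h1 : ‖fderiv ℂ V₀ (Θ x) (Pi.single b X)‖ ≤ ‖locGrad V₀ (Θ x)‖ * ‖X‖ := by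
    rw [← locGrad_apply_apply]
    exact ((locGrad V₀ (Θ x) b).le_opNorm X).trans
      (mul_le_mul_of_nonneg_right (norm_le_pi_norm _ b) (norm_nonneg X))
  have h2 : ‖fderiv ℂ V₀ (Θ x) (M' (Pi.single b X))‖ ≤ ‖locGrad V₀ (Θ x)‖ * (cM * ‖X‖) :=
    (norm_fderiv_apply_le_locGrad V₀ (Θ x) _).trans (mul_le_mul_of_nonneg_left (hM' X) (norm_nonneg _))
  calc ‖fderiv ℂ V₀ (Θ x) (Pi.single b X) - fderiv ℂ V₀ (Θ x) (M' (Pi.single b X))‖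
      ≤ ‖locGrad V₀ (Θ x)‖ * ‖X‖ + ‖locGrad V₀ (Θ x)‖ * (cM * ‖X‖) := (norm_sub_le _ _).trans (add_le_add h1 h2)
    _ = ‖locGrad V₀ (Θ x)‖ * (1 + cM) * ‖X‖ := by ring

end Summit.QuantumFields.BalabanUV.T4Continuum.ShellMeasureGradientTailPairing

end
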